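import Literature.Dynamics.Homogeneous.OrthogonalGroupOrbitClosuresK3Plane
import HarnessLib

/-!
# Plane-preserving isometries and skew maps act on the frame of a K3 period vector by rotations

Topic `Literature/Dynamics/Homogeneous`; theorems only (no new notion, no named fact — D-0026), on
top of `OrthogonalGroupOrbitClosuresK3Plane`. In the Ratner-theoretic proof of
`Literature.Dynamics.Homogeneous.Verbitsky2017_orbitClosure_trichotomy_K3`
[Verbitsky2017ErgodicErratum, §2.3] the candidate Ratner group `S = SO(P_x^⊥)°·SO(P_x)` of the
frame `(Re x, Im x)` of a period vector `x ∈ D` (Lie algebra `𝔰𝔬(V₀) ⊕ 𝔰𝔬(V₁)` of the erratum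
§2.1 classification) consists of isometries of `Λ_{K3} ⊗ ℝ` preserving the plane
`P_x = ⟨Re x, Im x⟩`; this file records, in the frame's own coordinates and without any Lie
theory, what such maps do to the frame:

* `k3Frame_coord_eq` — coordinates in the (orthogonal, conformal) frame by pairing;
* `k3_skew_frame_rotation` — a SKEW map preserving `P_x` acts on the frame by an infinitesimal
  rotation: `f Re x = θ Im x`, `f Im x = −θ Re x` (`𝔰𝔬(P_x)` is a line);
* `k3_isometry_frame_orthogonal` — an ISOMETRY preserving `P_x` acts on the frame by `O(2)`:
  `g Re x = c Re x + s Im x`, `g Im x = ε(−s Re x + c Im x)`, `c² + s² = 1`, `ε = ±1`;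
* `k3_frame_rotation_of_preconnected` — on a PRECONNECTED set `S ∋ 1` of plane-preserving
  isometries (e.g. a connected Ratner group) `ε ≡ 1` (the determinant of `g|_{P_x}` is a
  continuous function of `g` with values `±1`; intermediate value theorem), so every `g ∈ S`
  ROTATES the frame — the hypothesis of `k3_frame_fixed_up_to_sign_of_rotation`
  (`…Commutant`), which then gives `±1` on the frame for the integral elements in case (iii).

## References

* [Verbitsky2017ErgodicErratum] M. Verbitsky, Ergodic complex structures on hyperkähler manifolds:
  an erratum, arXiv:1708.05802 (2017), §2.3 (proof of the Theorem), §2.1.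
* [Huybrechts2016K3] D. Huybrechts, Lectures on K3 Surfaces, CUP 2016, Ch. 6 Prop. 1.5 (the frame
  `Re x ⊥ Im x`, `(Re x)² = (Im x)² > 0` of a period point).
-/

noncomputable section

namespace Literature.Dynamics.Homogeneous

open Module
open scoped Matrix Topology
open Literature.AlgebraicGeometry Literature.AlgebraicGeometry.Surfaces

/-! ### Isometries and skew maps preserving the plane of a period vector act on the frame by
rotations -/

section FrameRotation

/-- Coordinates in the frame: a vector of `P_x` has unique coordinates `(a, b)` with respect to
`(Re x, Im x)`, computed by pairing: `a (Re x)² = (v . Re x)`, `b (Re x)² = (v . Im x)`. [folklore] -/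
theorem k3Frame_coord_eq {x : K3Index → ℂ} (hx : x ∈ k3PeriodDomain) {v : K3Index → ℝ} {a b : ℝ}
    (hv : v = a • (fun i => (x i).re) + b • (fun i => (x i).im)) :
    a * Matrix.toBilin' (k3Gram.map (Int.cast : ℤ → ℝ)) (fun i => (x i).re) (fun i => (x i).re) =
        Matrix.toBilin' (k3Gram.map (Int.cast : ℤ → ℝ)) v (fun i => (x i).re) ∧
      b * Matrix.toBilin' (k3Gram.map (Int.cast : ℤ → ℝ)) (fun i => (x i).re) (fun i => (x i).re) =
        Matrix.toBilin' (k3Gram.map (Int.cast : ℤ → ℝ)) v (fun i => (x i).im) := by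
  set B := Matrix.toBilin' (k3Gram.map (Int.cast : ℤ → ℝ)) with hB
  obtain ⟨h12, h11, hpos⟩ := (mem_k3PeriodDomain_iff_k3RForm hB x).1 hx
  have h21 : B (fun i => (x i).im) (fun i => (x i).re) = 0 := by rw [k3RForm_comm]; exact h12
  rw [hv]
  refine ⟨?_, ?_⟩
  · rw [LinearMap.BilinForm.add_left, LinearMap.BilinForm.smul_left, LinearMap.BilinForm.smul_left,
      h21, mul_zero, add_zero]
  · rw [LinearMap.BilinForm.add_left, LinearMap.BilinForm.smul_left, LinearMap.BilinForm.smul_left,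
      h12, ← h11, mul_zero, zero_add]

/-- **A skew map preserving the plane rotates the frame infinitesimally**: if `f` is skew for the
K3 form and maps `Re x`, `Im x` into `P_x` (`x ∈ D`), then `f (Re x) = θ Im x`,
`f (Im x) = −θ Re x` for one real `θ` (`𝔰𝔬(P_x) ≅ 𝔰𝔬(2)` is a line; `Re x ⊥ Im x`,
`(Re x)² = (Im x)²`). [folklore] -/
theorem k3_skew_frame_rotation {x : K3Index → ℂ} (hx : x ∈ k3PeriodDomain)
    {f : Module.End ℝ (K3Index → ℝ)}
    (hf : ∀ u w, Matrix.toBilin' (k3Gram.map (Int.cast : ℤ → ℝ)) (f u) w =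
      -Matrix.toBilin' (k3Gram.map (Int.cast : ℤ → ℝ)) u (f w))
    {a b a' b' : ℝ} (hR : f (fun i => (x i).re) = a • (fun i => (x i).re) + b • (fun i => (x i).im))
    (hI : f (fun i => (x i).im) = a' • (fun i => (x i).re) + b' • (fun i => (x i).im)) :
    a = 0 ∧ b' = 0 ∧ a' = -b := by
  set B := Matrix.toBilin' (k3Gram.map (Int.cast : ℤ → ℝ)) with hB
  obtain ⟨h12, h11, hpos⟩ := (mem_k3PeriodDomain_iff_k3RForm hB x).1 hx
  obtain ⟨c1, c2⟩ := k3Frame_coord_eq hx hR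
  obtain ⟨d1, d2⟩ := k3Frame_coord_eq hx hI
  set R : K3Index → ℝ := fun i => (x i).re with hRdef
  set I : K3Index → ℝ := fun i => (x i).im with hIdef
  have hq : B R R ≠ 0 := hpos.ne'
  -- skewness on the frame
  have s1 : B (f R) R = 0 := by
    have h' := hf R R
    have hsym : B R (f R) = B (f R) R := k3RForm_comm _ _
    linarith
  have s2 : B (f I) I = 0 := by
    have h' := hf I I
    have hsym : B I (f I) = B (f I) I := k3RForm_comm _ _
    linarith
  have s3 : B (f R) I = -B (f I) R := by
    rw [hf R I, k3RForm_comm]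
  refine ⟨?_, ?_, ?_⟩
  · have : a * B R R = 0 := by rw [c1, s1]
    exact (mul_eq_zero.1 this).resolve_right hq
  · have : b' * B R R = 0 := by rw [d2, s2]
    exact (mul_eq_zero.1 this).resolve_right hq
  · have : (a' + b) * B R R = 0 := by rw [add_mul, d1, c2, s3]; ring
    have := (mul_eq_zero.1 this).resolve_right hq
    linarith

/-- **An isometry preserving the plane acts on the frame by `O(2)`**: if `g` preserves the K3 form
and maps `Re x`, `Im x` into `P_x` (`x ∈ D`), then `g Re x = c Re x + s Im x`,
`g Im x = ε(−s Re x + c Im x)` with `c² + s² = 1` and `ε = ±1`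
(`ε = c b − s a` the determinant of `g|_{P_x}` in the frame). [folklore] -/
theorem k3_isometry_frame_orthogonal {x : K3Index → ℂ} (hx : x ∈ k3PeriodDomain)
    {g : Matrix K3Index K3Index ℝ}
    (hg : ∀ u w, Matrix.toBilin' (k3Gram.map (Int.cast : ℤ → ℝ)) (g *ᵥ u) (g *ᵥ w) =
      Matrix.toBilin' (k3Gram.map (Int.cast : ℤ → ℝ)) u w)
    {c s a b : ℝ} (hR : g *ᵥ (fun i => (x i).re) = c • (fun i => (x i).re) + s • (fun i => (x i).im))
    (hI : g *ᵥ (fun i => (x i).im) = a • (fun i => (x i).re) + b • (fun i => (x i).im)) :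
    c * c + s * s = 1 ∧ a = -(c * b - s * a) * s ∧ b = (c * b - s * a) * c ∧
      ((c * b - s * a) = 1 ∨ (c * b - s * a) = -1) := by
  set B := Matrix.toBilin' (k3Gram.map (Int.cast : ℤ → ℝ)) with hB
  obtain ⟨h12, h11, hpos⟩ := (mem_k3PeriodDomain_iff_k3RForm hB x).1 hx
  set R : K3Index → ℝ := fun i => (x i).re with hRdef
  set I : K3Index → ℝ := fun i => (x i).im with hIdef
  have hq : B R R ≠ 0 := hpos.ne'
  have h21 : B I R = 0 := by rw [k3RForm_comm]; exact h12
  -- the three isometry relations in coordinates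
  have e1 : (c * c + s * s) * B R R = B R R := by
    have := hg R R
    rw [hR, twistorChain_comb2 B k3RForm_comm, h12, ← h11] at this
    linarith
  have e2 : (a * a + b * b) * B R R = B R R := by
    have := hg I I
    rw [hI, twistorChain_comb2 B k3RForm_comm, h12, ← h11] at this
    linarith
  have e3 : (c * a + s * b) * B R R = 0 := by
    have h := hg R I
    rw [hR, hI, h12] at h
    simp only [map_add, map_smul, LinearMap.add_apply, LinearMap.smul_apply, smul_eq_mul, h12, h21]
      at h
    rw [← h11] at h
    linarith
  have hcs : c * c + s * s = 1 := by
    have : (c * c + s * s - 1) * B R R = 0 := by linarith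
    have := (mul_eq_zero.1 this).resolve_right hq
    linarith
  have hab : a * a + b * b = 1 := by
    have : (a * a + b * b - 1) * B R R = 0 := by linarith
    have := (mul_eq_zero.1 this).resolve_right hq
    linarith
  have hperp : c * a + s * b = 0 := (mul_eq_zero.1 e3).resolve_right hq
  set ε := c * b - s * a with hε
  have hε2 : ε * ε = 1 := by
    have : ε * ε = (c * c + s * s) * (a * a + b * b) - (c * a + s * b) * (c * a + s * b) := by
      rw [hε]; ring
    rw [this, hcs, hab, hperp]; ring
  refine ⟨hcs, ?_, ?_, ?_⟩
  · linear_combination (-a) * hcs + c * hperp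
  · linear_combination (-b) * hcs + s * hperp
  · have : (ε - 1) * (ε + 1) = 0 := by nlinarith [hε2]
    rcases mul_eq_zero.1 this with h | h
    · exact Or.inl (by linarith)
    · exact Or.inr (by linarith)

/-- **On a connected family of plane-preserving isometries through `1`, the frame is ROTATED.**
Let `S` be a preconnected set of real matrices containing `1`, each preserving the K3 form and
mapping the frame `(Re x, Im x)` of `x ∈ D` into its plane `P_x`. Then every `g ∈ S` rotates
(–scales trivially) the frame: `g Re x = c Re x + s Im x`, `g Im x = −s Re x + c Im x`. (The
determinant `ε(g) = ±1` of `g|_{P_x}` is a continuous — polynomial — function of `g`, equal to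
`1` at `g = 1`, so `ε ≡ 1` by the intermediate value theorem.) With the Ratner group
`S = SO(P_x^⊥)°·SO(P_x)` (closed, CONNECTED) this supplies the hypothesis of
`k3_frame_fixed_up_to_sign_of_rotation` for every `δ ∈ Γ ∩ S`. [folklore] -/
theorem k3_frame_rotation_of_preconnected {x : K3Index → ℂ} (hx : x ∈ k3PeriodDomain)
    {S : Set (Matrix K3Index K3Index ℝ)} (hS : IsPreconnected S) (h1 : (1 : Matrix _ _ ℝ) ∈ S)
    (hiso : ∀ g ∈ S, ∀ u w, Matrix.toBilin' (k3Gram.map (Int.cast : ℤ → ℝ)) (g *ᵥ u) (g *ᵥ w) =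
      Matrix.toBilin' (k3Gram.map (Int.cast : ℤ → ℝ)) u w)
    (hP : ∀ g ∈ S, (∃ c s : ℝ, g *ᵥ (fun i => (x i).re) =
        c • (fun i => (x i).re) + s • (fun i => (x i).im)) ∧
      (∃ a b : ℝ, g *ᵥ (fun i => (x i).im) = a • (fun i => (x i).re) + b • (fun i => (x i).im)))
    {g : Matrix K3Index K3Index ℝ} (hg : g ∈ S) :
    ∃ c s : ℝ, g *ᵥ (fun i => (x i).re) = c • (fun i => (x i).re) + s • (fun i => (x i).im) ∧
      g *ᵥ (fun i => (x i).im) = (-s) • (fun i => (x i).re) + c • (fun i => (x i).im) := by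
  set B := Matrix.toBilin' (k3Gram.map (Int.cast : ℤ → ℝ)) with hB
  obtain ⟨h12, h11, hpos⟩ := (mem_k3PeriodDomain_iff_k3RForm hB x).1 hx
  set R : K3Index → ℝ := fun i => (x i).re with hRdef
  set I : K3Index → ℝ := fun i => (x i).im with hIdef
  have hq : B R R ≠ 0 := hpos.ne'
  -- the determinant of `g|_P` as a function of `g`
  let ε : Matrix K3Index K3Index ℝ → ℝ := fun g =>
    (B (g *ᵥ R) R * B (g *ᵥ I) I - B (g *ᵥ R) I * B (g *ᵥ I) R) / (B R R * B R R)
  have hεc : Continuous ε := by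
    have hmv : ∀ v : K3Index → ℝ, Continuous fun g : Matrix K3Index K3Index ℝ => g *ᵥ v :=
      fun v => Continuous.matrix_mulVec continuous_id continuous_const
    have hpair : ∀ v w : K3Index → ℝ, Continuous fun g : Matrix K3Index K3Index ℝ => B (g *ᵥ v) w := by
      intro v w
      have : (fun g : Matrix K3Index K3Index ℝ => B (g *ᵥ v) w) =
          (fun u => B u w) ∘ fun g : Matrix K3Index K3Index ℝ => g *ᵥ v := rfl
      rw [this]
      refine Continuous.comp ?_ (hmv v)
      exact (B.flip w).continuous_of_finiteDimensional
    refine Continuous.div_const ?_ _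
    exact ((hpair R R).mul (hpair I I)).sub ((hpair R I).mul (hpair I R))
  -- its value on `S`: the `ε` of `k3_isometry_frame_orthogonal`
  have hεval : ∀ g ∈ S, ∀ c s a b : ℝ, g *ᵥ R = c • R + s • I → g *ᵥ I = a • R + b • I →
      ε g = c * b - s * a := by
    intro g hg c s a b hR hI
    obtain ⟨c1, c2⟩ := k3Frame_coord_eq hx hR
    obtain ⟨d1, d2⟩ := k3Frame_coord_eq hx hI
    show (B (g *ᵥ R) R * B (g *ᵥ I) I - B (g *ᵥ R) I * B (g *ᵥ I) R) / (B R R * B R R) = c * b - s * a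
    rw [← c1, ← c2, ← d1, ← d2]
    field_simp
    ring
  have hεS : ∀ g ∈ S, ε g = 1 ∨ ε g = -1 := by
    intro g hg
    obtain ⟨⟨c, s, hR⟩, ⟨a, b, hI⟩⟩ := hP g hg
    obtain ⟨-, -, -, hε⟩ := k3_isometry_frame_orthogonal hx (hiso g hg) hR hI
    rw [hεval g hg c s a b hR hI]
    exact hε
  have hε1 : ε 1 = 1 := by
    rw [hεval 1 h1 1 0 0 1 (by simp) (by simp)]
    ring
  -- intermediate value: `ε g = 1` for all `g ∈ S`
  have hεg : ε g = 1 := by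
    rcases hεS g hg with h | h
    · exact h
    · exfalso
      have hsub := hS.intermediate_value hg h1 hεc.continuousOn
      rw [h, hε1] at hsub
      obtain ⟨g₀, hg₀, hg₀0⟩ := hsub (show (0 : ℝ) ∈ Set.Icc (-1 : ℝ) 1 from ⟨by norm_num, by norm_num⟩)
      rcases hεS g₀ hg₀ with h0 | h0
      · rw [hg₀0] at h0; norm_num at h0
      · rw [hg₀0] at h0; norm_num at h0
  obtain ⟨⟨c, s, hR⟩, ⟨a, b, hI⟩⟩ := hP g hg
  obtain ⟨-, ha, hb, -⟩ := k3_isometry_frame_orthogonal hx (hiso g hg) hR hI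
  have hεeq : c * b - s * a = 1 := by rw [← hεval g hg c s a b hR hI]; exact hεg
  rw [hεeq] at ha hb
  refine ⟨c, s, hR, ?_⟩
  rw [hI, ha, hb]
  simp

end FrameRotation

end Literature.Dynamics.Homogeneous
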